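import Literature.Topology.FourManifolds.SeifertAlgebraicModels
import Literature.Topology.FourManifolds.SeifertAlgebraicModelsWeierstrass
import Literature.Topology.FourManifolds.SeifertAlgebraicModelsGrowth
import Literature.Topology.FourManifolds.SeifertAlgebraicModelsLevelIsotopy
import Literature.Topology.FourManifolds.IsotopyProofs
import HarnessLib

/-!
# Seifert's algebraic models: reduction to the existence of a defining function

Topic `Literature/Topology/FourManifolds` (fifth rung of the proof of the named fact
`Literature.Topology.FourManifolds.Seifert1936_algebraicModel`, `SeifertAlgebraicModels.lean`).
**Everything in this file is proved; no named fact is introduced.**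

Akbulut–King, *Topology of Real Algebraic Sets* (1992), Ch. II, Thm. 2.8.2 for `V = ℝⁿ`,
`W = L = P = ∅` is proved in two halves: **Assertion 2.8.2.1** (PDF p. 71: a smooth function
`f : ℝⁿ → ℝ` with `f⁻¹(0) = M` regular and `f > 0` off a compact set — for `W = ∅` this is the
statement that the compact hypersurface `M` is two-sided and bounds) and **the approximation
argument** (PDF p. 72: Weierstrass approximation `p` of `f` on `N'`, the correction
`λ = p + (r²/(3b))ᵐ`, and "by transversality, the zeroes `X` of `λ` are a manifold isotopic to
`M`").  This file proves the second half as an implication from the first: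

* `Literature.Topology.FourManifolds.Seifert1936_algebraicModel_of_definingFunction` — if the
  image of the smooth embedding `e : M → ℝᵐ⁺¹` of the compact manifold `M` is the regular zero
  set of a smooth `g : ℝᵐ⁺¹ → ℝ` with `g ≥ 1` off a ball, then the conclusion of
  `Seifert1936_algebraicModel` holds for `e`: there are a polynomial `f` nonsingular along
  `Z(f)`, and a smooth isotopy of embeddings from `e` to an embedding with image `Z(f)`.

The ingredients are the tree's `exists_mvPolynomial_close_C1_of_contDiff` (Lemma 2.8.1 (a),
`SeifertAlgebraicModelsWeierstrass.lean`), `exists_abs_eval_lt_pow_of_le_norm_sq` and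
`exists_normSqPow_le_of_norm_sq_le` (the correction term, `SeifertAlgebraicModelsGrowth.lean`),
`exists_ambientIsotopy_image_levelSet_eq` (the level-set isotopy,
`SeifertAlgebraicModelsLevelIsotopy.lean`) and `Manifold.IsSmoothEmbedding.diffeomorph_comp`
(an ambient isotopy composed with an embedding is an isotopy of embeddings,
`ClosedBallProofs.lean`).  What remains for `Seifert1936_algebraicModel_holds` is Assertion
2.8.2.1 for `W = ∅`: every compact smooth hypersurface of `ℝⁿ` has such a defining function
(two-sidedness and the Jordan–Brouwer separation theorem).

## References

* S. Akbulut, H. King, *Topology of Real Algebraic Sets*, MSRI Publ. 25, Springer (1992), Ch. II,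
  Thm. 2.8.2 and its proof (PDF pp. 70–72). [AkbulutKing1992]
* H. Seifert, *Algebraische Approximation von Mannigfaltigkeiten*, Math. Z. 41 (1936) 1–17.
  [Seifert1936]
-/

open scoped Topology ContDiff Manifold
open Function Set Filter Metric MvPolynomial

noncomputable section

namespace Literature.Topology.FourManifolds

universe u

/-- **Nonsingularity from a non-vanishing derivative**: if the polynomial function `x ↦ f(x)`
has `Df(x) ≠ 0` at every zero, then `f` is nonsingular along its zero set in the sense of
`Literature.Topology.FourManifolds.IsNonsingularAlongZeroSet` (some `∂f/∂xᵢ(x) ≠ 0`), since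
`Df(x) v = ∑ᵢ (∂f/∂xᵢ)(x) vᵢ`. [folklore] -/
theorem isNonsingularAlongZeroSet_of_fderiv_ne_zero {n : ℕ} {f : MvPolynomial (Fin n) ℝ}
    (h : ∀ x : EuclideanSpace ℝ (Fin n), eval (WithLp.ofLp x) f = 0 →
      fderiv ℝ (fun y : EuclideanSpace ℝ (Fin n) => eval (WithLp.ofLp y) f) x ≠ 0) :
    IsNonsingularAlongZeroSet n f := by
  intro x hx
  by_contra hall
  push Not at hall
  apply h x hx
  ext v
  rw [fderiv_mvPolynomial_eval_ofLp_apply]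
  simp [hall]

/-- **Seifert's theorem from a defining function** (Akbulut–King, Ch. II, proof of Thm. 2.8.2
for `V = ℝⁿ`, `W = L = ∅`, everything after Assertion 2.8.2.1).  Let `M` be a compact smooth
`m`-manifold, `e : M → ℝᵐ⁺¹` a smooth embedding, and `g : ℝᵐ⁺¹ → ℝ` smooth with
`g⁻¹(0) = e(M)`, `Dg ≠ 0` on `g⁻¹(0)` and `g ≥ 1` outside the ball of radius `R`.  Then there
are a polynomial `f` nonsingular along `Z(f)`, a smooth embedding `e'` with image `Z(f)`, and a
smooth isotopy of embeddings `H` from `e` to `e'` — the conclusion of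
`Literature.Topology.FourManifolds.Seifert1936_algebraicModel` for `e`.  (Proof: approximate `g`
in `C¹` on the ball of radius `2R` by a polynomial `p`, add `(‖x‖²/(3R²))ᵏ` for `k ≫ 0` to
remove far zeros, and move `e(M) = g⁻¹(0)` onto the zeros by the level-set isotopy.)
[cite: AkbulutKing1992, Thm. 2.8.2 (V = ℝⁿ), proof pp. 71–72] -/
theorem Seifert1936_algebraicModel_of_definingFunction (m : ℕ) (M : Type u) [TopologicalSpace M]
    [T2Space M] [SecondCountableTopology M] [CompactSpace M]
    [ChartedSpace (EuclideanSpace ℝ (Fin m)) M] [IsManifold (𝓡 m) ∞ M]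
    (e : M → EuclideanSpace ℝ (Fin (m + 1)))
    (he : Manifold.IsSmoothEmbedding (𝓡 m) (𝓡 (m + 1)) ∞ e)
    (g : EuclideanSpace ℝ (Fin (m + 1)) → ℝ) (hg : ContDiff ℝ ∞ g)
    (hgZ : ∀ x, g x = 0 ↔ x ∈ range e) (hreg : ∀ x, g x = 0 → fderiv ℝ g x ≠ 0)
    {R : ℝ} (hfar : ∀ x, R ≤ ‖x‖ → 1 ≤ g x) :
    ∃ (f : MvPolynomial (Fin (m + 1)) ℝ) (e' : M → EuclideanSpace ℝ (Fin (m + 1)))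
      (H : ℝ → M → EuclideanSpace ℝ (Fin (m + 1))),
      IsNonsingularAlongZeroSet (m + 1) f ∧
      Manifold.IsSmoothEmbedding (𝓡 m) (𝓡 (m + 1)) ∞ e' ∧ range e' = realZeroSet (m + 1) f ∧
      H 0 = e ∧ H 1 = e' ∧
      ContMDiff (𝓘(ℝ, ℝ).prod (𝓡 m)) (𝓡 (m + 1)) ∞ (uncurry H) ∧
      ∀ t : ℝ, Manifold.IsSmoothEmbedding (𝓡 m) (𝓡 (m + 1)) ∞ (H t) := by
  classical
  -- Step 0: normalise `R ≥ 1`; `{|g| ≤ 1/2}` is compact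
  set R₁ : ℝ := max R 1 with hR₁_def
  have hR₁ : 1 ≤ R₁ := le_max_right _ _
  have hfar₁ : ∀ x, R₁ ≤ ‖x‖ → 1 ≤ g x := fun x hx => hfar x ((le_max_left _ _).trans hx)
  have hgc : Continuous g := hg.continuous
  have hsub : ∀ {r : ℝ}, r < 1 → {x : EuclideanSpace ℝ (Fin (m + 1)) | |g x| ≤ r} ⊆ ball 0 R₁ :=
    fun {r} hr x hx => by
      rw [mem_ball_zero_iff]
      by_contra hxR
      have h1 := hfar₁ x (le_of_not_gt hxR)
      have h2 : g x ≤ r := (le_abs_self _).trans hx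
      linarith
  have hK : IsCompact {x : EuclideanSpace ℝ (Fin (m + 1)) | |g x| ≤ 1 / 2} :=
    Metric.isCompact_of_isClosed_isBounded (isClosed_le (continuous_abs.comp hgc)
      continuous_const) (isBounded_ball.subset (hsub (by norm_num)))
  -- Step 1: the level-set isotopy constants
  obtain ⟨β, δ, hβ, hβα, hδ, hlevel⟩ :=
    exists_ambientIsotopy_image_levelSet_eq hg (by norm_num : (0 : ℝ) < 1 / 2) hK hreg
  set δ' : ℝ := min δ β with hδ'_def
  have hδ' : 0 < δ' := lt_min hδ hβ
  have hδ'δ : δ' ≤ δ := min_le_left _ _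
  have hδ'β : δ' ≤ β := min_le_right _ _
  -- Step 2: Weierstrass approximation of `g` on the ball of radius `2 R₁`
  set b : ℝ := R₁ ^ 2 with hb_def
  have hb : 0 < b := by positivity
  obtain ⟨p, hp0, hp1⟩ := exists_mvPolynomial_close_C1_of_contDiff (hg.of_le (by simp))
    (isCompact_closedBall (0 : EuclideanSpace ℝ (Fin (m + 1))) (2 * R₁))
    (lt_min (half_pos hδ') (by norm_num : (0 : ℝ) < 1 / 2))
  -- Step 3: the correction `(‖x‖²/(3b))^k`, `k` large
  obtain ⟨k₁, hk₁⟩ := exists_abs_eval_lt_pow_of_le_norm_sq p hb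
  obtain ⟨k₂, hk₂⟩ := exists_normSqPow_le_of_norm_sq_le
    (F := EuclideanSpace ℝ (Fin (m + 1))) hb (half_pos hδ')
  set k : ℕ := max k₁ k₂ with hk_def
  set Q : MvPolynomial (Fin (m + 1)) ℝ := (C (3 * b)⁻¹ * ∑ i : Fin (m + 1), X i ^ 2) ^ k
    with hQ_def
  set lam : MvPolynomial (Fin (m + 1)) ℝ := p + Q with hlam_def
  set pf : EuclideanSpace ℝ (Fin (m + 1)) → ℝ := fun x => eval (WithLp.ofLp x) p with hpf_def
  set Qf : EuclideanSpace ℝ (Fin (m + 1)) → ℝ := fun x => (‖x‖ ^ 2 / (3 * b)) ^ k with hQf_def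
  set lamf : EuclideanSpace ℝ (Fin (m + 1)) → ℝ := fun x => eval (WithLp.ofLp x) lam
    with hlamf_def
  have hQf : ∀ x, eval (WithLp.ofLp x) Q = Qf x := fun x => eval_normSqPoly_pow b k x
  have hlamf_eq : lamf = fun x => pf x + Qf x := by
    funext x; simp only [hlamf_def, hlam_def, hpf_def, map_add, hQf]
  have hlamC : ContDiff ℝ ∞ lamf := contDiff_mvPolynomial_eval_ofLp lam
  have hpfd : Differentiable ℝ pf := (contDiff_mvPolynomial_eval_ofLp p (N := 1)).differentiable
    (by simp)
  have hQfd : ∀ x, DifferentiableAt ℝ Qf x := fun x => (hasFDerivAt_normSqPow b k x).differentiableAt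
  have hQf0 : ∀ x, 0 ≤ Qf x := fun x => by positivity
  -- bounds on the ball of radius `R₁` (`‖x‖² ≤ b ≤ 2b`)
  have hQsmall : ∀ x : EuclideanSpace ℝ (Fin (m + 1)), ‖x‖ ≤ R₁ →
      Qf x ≤ δ' / 2 ∧ ‖fderiv ℝ Qf x‖ ≤ δ' / 2 := by
    intro x hx
    have hx2 : ‖x‖ ^ 2 ≤ 2 * b := by
      rw [hb_def]; nlinarith [norm_nonneg x, sq_nonneg ‖x‖]
    exact hk₂ k (le_max_right _ _) x hx2
  have hpsmall : ∀ x : EuclideanSpace ℝ (Fin (m + 1)), ‖x‖ ≤ 2 * R₁ →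
      |pf x - g x| < δ' / 2 ∧ |pf x - g x| < 1 / 2 ∧ ‖fderiv ℝ pf x - fderiv ℝ g x‖ < δ' / 2 := by
    intro x hx
    have hxK : x ∈ closedBall (0 : EuclideanSpace ℝ (Fin (m + 1))) (2 * R₁) :=
      mem_closedBall_zero_iff.2 hx
    have h0 := hp0 x hxK
    have h1 := hp1 x hxK
    exact ⟨h0.trans_le (min_le_left _ _), h0.trans_le (min_le_right _ _),
      h1.trans_le (min_le_left _ _)⟩
  -- Step 4: closeness of `lamf` to `g` on `{|g| ≤ β}` and location of the zeros of `lamf`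
  have hclose : ∀ x, ‖x‖ ≤ R₁ →
      |lamf x - g x| ≤ δ' ∧ ‖fderiv ℝ lamf x - fderiv ℝ g x‖ ≤ δ' := by
    intro x hx
    obtain ⟨hq, hDq⟩ := hQsmall x hx
    obtain ⟨hpg, -, hDpg⟩ := hpsmall x (hx.trans (by linarith))
    refine ⟨?_, ?_⟩
    · rw [hlamf_eq]
      change |pf x + Qf x - g x| ≤ δ'
      calc |pf x + Qf x - g x| = |(pf x - g x) + Qf x| := by ring_nf
        _ ≤ |pf x - g x| + |Qf x| := abs_add_le _ _
        _ ≤ δ' / 2 + δ' / 2 := add_le_add hpg.le (by rw [abs_of_nonneg (hQf0 x)]; exact hq)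
        _ = δ' := by ring
    · rw [hlamf_eq, fderiv_fun_add (hpfd x) (hQfd x)]
      calc ‖fderiv ℝ pf x + fderiv ℝ Qf x - fderiv ℝ g x‖
          = ‖(fderiv ℝ pf x - fderiv ℝ g x) + fderiv ℝ Qf x‖ := by abel_nf
        _ ≤ ‖fderiv ℝ pf x - fderiv ℝ g x‖ + ‖fderiv ℝ Qf x‖ := norm_add_le _ _
        _ ≤ δ' / 2 + δ' / 2 := add_le_add hDpg.le hDq
        _ = δ' := by ring
  have hβR : ∀ x, |g x| ≤ β → ‖x‖ ≤ R₁ := fun x hx =>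
    (mem_ball_zero_iff.1 (hsub (by linarith) hx)).le
  have hzeros : ∀ x, lamf x = 0 → ‖x‖ < R₁ := by
    intro x hx0
    by_contra hxR
    have hxR' : R₁ ≤ ‖x‖ := le_of_not_gt hxR
    have hval : lamf x = pf x + Qf x := by rw [hlamf_eq]
    rcases le_or_gt (2 * R₁) ‖x‖ with hfarx | hnear
    · -- far out: the correction dominates
      have h4b : 4 * b ≤ ‖x‖ ^ 2 := by rw [hb_def]; nlinarith
      have hlt := hk₁ k (le_max_left _ _) x h4b
      have : 0 < pf x + Qf x := by
        have := neg_abs_le (pf x)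
        change |eval (WithLp.ofLp x) p| < Qf x at hlt
        change 0 < eval (WithLp.ofLp x) p + Qf x
        linarith
      linarith
    · -- the annulus: `g ≥ 1` and `p` is `1/2`-close to `g`
      obtain ⟨-, hpg, -⟩ := hpsmall x hnear.le
      have h1 := hfar₁ x hxR'
      have : 0 < pf x + Qf x := by
        have := hQf0 x
        have := (abs_lt.1 hpg).1
        linarith
      linarith
  have hzerosβ : ∀ x, lamf x = 0 → |g x| ≤ β := by
    intro x hx0
    have hx := (hzeros x hx0).le
    have := (hclose x hx).1
    rw [hx0, zero_sub, abs_neg] at this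
    exact this.trans hδ'β
  -- Step 5: the level-set isotopy for `g₁ = lamf`
  obtain ⟨⟨F, hF⟩, hregl⟩ := hlevel lamf hlamC
    (fun x hx => ((hclose x (hβR x hx)).1.trans hδ'δ))
    (fun x hx => ((hclose x (hβR x hx)).2.trans hδ'δ))
  have hF' : F.toFun 1 '' range e = {x | lamf x = 0} := by
    have h1 : {x : EuclideanSpace ℝ (Fin (m + 1)) | g x = 0} = range e :=
      Set.ext fun x => hgZ x
    rw [← h1, hF]
    ext x
    exact ⟨fun hx => hx.1, fun hx => ⟨hx, hzerosβ x hx⟩⟩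
  -- Step 6: assemble
  refine ⟨lam, F.toFun 1 ∘ e, fun t => F.toFun t ∘ e, ?_, ?_, ?_, ?_, rfl, ?_, ?_⟩
  · exact isNonsingularAlongZeroSet_of_fderiv_ne_zero fun x hx =>
      hregl x hx (hzerosβ x hx)
  · exact he.diffeomorph_comp (F.toDiffeomorph 1)
  · rw [range_comp, hF']
    ext x
    simp [realZeroSet, hlamf_def]
  · funext y
    simp [F.map_zero]
  · exact F.contMDiff.comp (contMDiff_fst.prodMk (he.contMDiff.comp contMDiff_snd))
  · exact fun t => he.diffeomorph_comp (F.toDiffeomorph t)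

end Literature.Topology.FourManifolds
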